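import Summits.CriticalPhenomena.PercolationContinuityZ3.Theorems.Transplant.SkelFrmFromBParamsClearF
import Summits.CriticalPhenomena.PercolationContinuityZ3.Theorems.Transplant.SkelFrmBParamsClearF
import Summits.CriticalPhenomena.PercolationContinuityZ3.Theorems.Transplant.SkelFrmFromBParamsFramesF2
import Summits.CriticalPhenomena.PercolationContinuityZ3.Theorems.Transplant.SkelFrmBParamsFramesF2
import Summits.CriticalPhenomena.PercolationContinuityZ3.Theorems.Transplant.SkelPhiFaceClearFloorsY
import Summits.CriticalPhenomena.PercolationContinuityZ3.Theorems.Transplant.PlanarSkeletonFrmFromDefs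
import Summits.CriticalPhenomena.PercolationContinuityZ3.Theorems.Transplant.PlanarSkeletonFrmDefs
import Summits.CriticalPhenomena.PercolationContinuityZ3.Theorems.Transplant.SkelPhiStepIDataNS
import HarnessLib
import Summits.CriticalPhenomena.PercolationContinuityZ3.Theorems.Transplant.SkelFrmBParamsFaceFloorsClrYF
/-!
# U-WAVE PORT (RULING D-U, lead g21 2026-08-26; WAVE-U-MANIFEST v3.1 row «SkelFrmBParamsFaceFloorsClrYF» ↦ «SkelFrmFromBParamsFaceFloorsClrYF») of the tree module
# `Transplant/SkelFrmBParamsFaceFloorsClrYF` onto the carrier `PlanarSkeletonFrmFrom` (frames only, cylinders connected from width `ℓ₀` on)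

ORIGINAL TITLE: (F) VALUE LAYER, N2 twin (hp-8 g42, 2026-08-23; F-DISCHARGE-MAP-N2 G18 y′ clearances): `port_frm.py` text of N1 `SkelNegBParamsFaceFloorsClrYF` (p1-g13) over

builds on p205010 (kernel theorem, internal audit signed; external expert review pending) — nothing in this file uses p205010; NOTHING is claimed about the
OPEN node U `SamePDropOfSkeletonFrmFrom₁` (nor U_s / the end state).  Lane `prim-bschramm`, seat `prim-bschramm-stmt` gen 26 (port pen, RULING M-11 family P-stmt; tool = p3-g26's port_u.py of record, registry-driven inputs); helper file
(`--supports stmt-CriticalPhenomena-4575 --as helper`).  PORT RULES r1–r4 of RULING D-U: declaration order and proof texts are those of the original,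
byte-identical except (i) the carrier token `PlanarSkeletonFrm ↦ PlanarSkeletonFrmFrom` (binders, `namespace`/`end` lines, qualified names of twinned
declarations), (ii) carrier-FREE declarations of the original (φ-level `Skelφ…` blocks and namespace-only arithmetic residents) are NOT re-declared —
this file imports the original and `export`s the twin-free residents (POLICY T / treatment (m1)); residents whose statement mentions a twinned
constant are copied, (iii) every carrier-binding declaration keeps its explicit binder `(Φ : PlanarSkeletonFrmFrom G)` in its own signature (r2).  Docstrings and citations are the original's.
-/

noncomputable section

open scoped Classical

namespace Summit.CriticalPhenomena.PercolationContinuityZ3.Theorems.Transplant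

namespace PlanarSkeletonFrmFrom

namespace NegB

open Literature.Probability.Percolation Literature.Probability.LatticeModels SimpleGraph
open Literature.Probability.Percolation.KozmaNitzan.Cells (oth sgOf sgOf_sign)
open SkelConc (Consts)
open Skelφ (yBoxLoT yBoxHiT)
open Skelφ.StepI (DataN)
open Neg

namespace KS

section ClrYF

/-- **`hclrLo`, case same**: at `yL := yLFs σ σh` (`σ := sgOf du`), on the hop side `σ·σh = 1` (so `0 ≤ v_L`) every region `k ≤ Nr` of the along y′-run
has its transverse floor above `M_u`, given `Nr + 1 ≤ c`. [cite: KozmaNitzan2024, §4 Lemma 11 (p. 22)] -/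
theorem hclrLo_YFs (κ : Consts) {V : Type} [DecidableEq V] [Countable V] {G : SimpleGraph V} [G.LocallyFinite] (Φ : PlanarSkeletonFrmFrom G) (t : V) (p : unitInterval) (D : Skelφ.StepI.DataNS V) (c : ℕ) (mk : ℕ) (g : ℕ) (f : ℕ) (hN : EqNumL κ Φ t p D g f) (du : MDir) {σh : ℤ} (hhop : sgOf du * σh = 1 → 0 ≤ vL κ Φ t p D g f) {Nr : ℕ} (hc : Nr + 1 ≤ c) :
    sgOf du * σh = 1 → ∀ k ≤ Nr, ((Mu D : ℕ) : ℤ) < yBoxLoT (nL κ Φ t p D g f) (vL κ Φ t p D g f) (KS0.R'0 κ Φ t p D mk) k +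
      sgOf du * (yLFs κ Φ t p D c mk g f (sgOf du) σh) 0 := by
  intro h
  have ha := yLFs_zero κ Φ t p D c mk g f (sgOf_sign du) σh
  rw [h, one_mul] at ha
  exact Skelφ.hclrP_of_clearF hN.v_le (hhop h) (KS0.R'0 κ Φ t p D mk) Nr (clo := (nL κ Φ t p D g f : ℤ) + nBF κ Φ t p D c mk - KS0.R'0 κ Φ t p D mk)
    (by linarith [ha]) (clearF_s κ Φ t p D c mk (nL κ Φ t p D g f) hc le_rfl)

/-- **`hclrHi`, case same**: on the opposite hop side `σ·σh = −1` (so `v_L ≤ 0`) every region's transverse ceiling stays below `−M_u`.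
[cite: KozmaNitzan2024, §4 Lemma 11 (p. 22)] -/
theorem hclrHi_YFs (κ : Consts) {V : Type} [DecidableEq V] [Countable V] {G : SimpleGraph V} [G.LocallyFinite] (Φ : PlanarSkeletonFrmFrom G) (t : V) (p : unitInterval) (D : Skelφ.StepI.DataNS V) (c : ℕ) (mk : ℕ) (g : ℕ) (f : ℕ) (hN : EqNumL κ Φ t p D g f) (du : MDir) {σh : ℤ} (hhop : sgOf du * σh = -1 → vL κ Φ t p D g f ≤ 0) {Nr : ℕ} (hc : Nr + 1 ≤ c) :
    sgOf du * σh = -1 → ∀ k ≤ Nr, yBoxHiT (nL κ Φ t p D g f) (vL κ Φ t p D g f) (KS0.R'0 κ Φ t p D mk) k +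
      sgOf du * (yLFs κ Φ t p D c mk g f (sgOf du) σh) 0 < -((Mu D : ℕ) : ℤ) := by
  intro h
  have ha := yLFs_zero κ Φ t p D c mk g f (sgOf_sign du) σh
  rw [h] at ha
  exact Skelφ.hclrM_of_clearF hN.v_le (hhop h) (KS0.R'0 κ Φ t p D mk) Nr (clo := (nL κ Φ t p D g f : ℤ) + nBF κ Φ t p D c mk - KS0.R'0 κ Φ t p D mk)
    (by linarith [ha]) (clearF_s κ Φ t p D c mk (nL κ Φ t p D g f) hc le_rfl)

/-- **`hclrLo`, steep transposed case** (`yL := yLFd σ σh`, `ℓBF < 2|hBF|`, `2·bF + 27 ≤ ℓBF` = `ℓBF_ge`). [cite: KozmaNitzan2024, §4 Lemma 11 (p. 22)] -/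
theorem hclrLo_YFd (κ : Consts) {V : Type} [DecidableEq V] [Countable V] {G : SimpleGraph V} [G.LocallyFinite] (Φ : PlanarSkeletonFrmFrom G) (t : V) (p : unitInterval) (D : Skelφ.StepI.DataNS V) (c : ℕ) (mk : ℕ) (g : ℕ) (f : ℕ) (hN : EqNumL κ Φ t p D g f) (du : MDir) {σh : ℤ} (hhop : sgOf du * σh = 1 → 0 ≤ vL κ Φ t p D g f) {Nr : ℕ} (hc : Nr + 1 ≤ c)
    (hside : ℓBF κ Φ t p D c mk < 2 * (hBF κ Φ t p D c mk).natAbs) (hℓb : 2 * bF κ Φ t p D c mk + 27 ≤ ℓBF κ Φ t p D c mk) :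
    sgOf du * σh = 1 → ∀ k ≤ Nr, ((Mu D : ℕ) : ℤ) < yBoxLoT (nL κ Φ t p D g f) (vL κ Φ t p D g f) (KS0.R'0 κ Φ t p D mk) k +
      sgOf du * (yLFd κ Φ t p D c mk g f (sgOf du) σh) 0 := by
  intro h
  have ha := yLFd_zero κ Φ t p D c mk g f (sgOf_sign du) σh
  rw [h, one_mul] at ha
  exact Skelφ.hclrP_of_clearF hN.v_le (hhop h) (KS0.R'0 κ Φ t p D mk) Nr (clo := (nL κ Φ t p D g f : ℤ) - KS0.R'0 κ Φ t p D mk + |hBF κ Φ t p D c mk|)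
    (by linarith [ha]) (clearF_d κ Φ t p D c mk (nL κ Φ t p D g f) hc le_rfl hside hℓb)

/-- **`hclrHi`, steep transposed case.** [cite: KozmaNitzan2024, §4 Lemma 11 (p. 22)] -/
theorem hclrHi_YFd (κ : Consts) {V : Type} [DecidableEq V] [Countable V] {G : SimpleGraph V} [G.LocallyFinite] (Φ : PlanarSkeletonFrmFrom G) (t : V) (p : unitInterval) (D : Skelφ.StepI.DataNS V) (c : ℕ) (mk : ℕ) (g : ℕ) (f : ℕ) (hN : EqNumL κ Φ t p D g f) (du : MDir) {σh : ℤ} (hhop : sgOf du * σh = -1 → vL κ Φ t p D g f ≤ 0) {Nr : ℕ} (hc : Nr + 1 ≤ c)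
    (hside : ℓBF κ Φ t p D c mk < 2 * (hBF κ Φ t p D c mk).natAbs) (hℓb : 2 * bF κ Φ t p D c mk + 27 ≤ ℓBF κ Φ t p D c mk) :
    sgOf du * σh = -1 → ∀ k ≤ Nr, yBoxHiT (nL κ Φ t p D g f) (vL κ Φ t p D g f) (KS0.R'0 κ Φ t p D mk) k +
      sgOf du * (yLFd κ Φ t p D c mk g f (sgOf du) σh) 0 < -((Mu D : ℕ) : ℤ) := by
  intro h
  have ha := yLFd_zero κ Φ t p D c mk g f (sgOf_sign du) σh
  rw [h] at ha
  exact Skelφ.hclrM_of_clearF hN.v_le (hhop h) (KS0.R'0 κ Φ t p D mk) Nr (clo := (nL κ Φ t p D g f : ℤ) - KS0.R'0 κ Φ t p D mk + |hBF κ Φ t p D c mk|)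
    (by linarith [ha]) (clearF_d κ Φ t p D c mk (nL κ Φ t p D g f) hc le_rfl hside hℓb)

/-- **`hclrLo`, flat transposed case** (`yL := yLFt σ σh`, `2|hBF| ≤ ℓBF`, `2·bF + 27 ≤ ℓBF`). [cite: KozmaNitzan2024, §4 Lemma 11 (p. 22)] -/
theorem hclrLo_YFt (κ : Consts) {V : Type} [DecidableEq V] [Countable V] {G : SimpleGraph V} [G.LocallyFinite] (Φ : PlanarSkeletonFrmFrom G) (t : V) (p : unitInterval) (D : Skelφ.StepI.DataNS V) (c : ℕ) (mk : ℕ) (g : ℕ) (f : ℕ) (hN : EqNumL κ Φ t p D g f) (du : MDir) {σh : ℤ} (hhop : sgOf du * σh = 1 → 0 ≤ vL κ Φ t p D g f) {Nr : ℕ} (hc : Nr + 1 ≤ c)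
    (htop : 2 * (hBF κ Φ t p D c mk).natAbs ≤ ℓBF κ Φ t p D c mk) (hℓb : 2 * bF κ Φ t p D c mk + 27 ≤ ℓBF κ Φ t p D c mk) :
    sgOf du * σh = 1 → ∀ k ≤ Nr, ((Mu D : ℕ) : ℤ) < yBoxLoT (nL κ Φ t p D g f) (vL κ Φ t p D g f) (KS0.R'0 κ Φ t p D mk) k +
      sgOf du * (yLFt κ Φ t p D c mk g f (sgOf du) σh) 0 := by
  intro h
  have ha := yLFt_zero κ Φ t p D c mk g f (sgOf_sign du) σh
  rw [h, one_mul] at ha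
  exact Skelφ.hclrP_of_clearF hN.v_le (hhop h) (KS0.R'0 κ Φ t p D mk) Nr
    (clo := (nL κ Φ t p D g f : ℤ) - KS0.R'0 κ Φ t p D mk + ((ℓBF κ Φ t p D c mk : ℤ) - |hBF κ Φ t p D c mk| - 11))
    (by linarith [ha]) (clearF_t κ Φ t p D c mk (nL κ Φ t p D g f) hc le_rfl htop hℓb)

/-- **`hclrHi`, flat transposed case.** [cite: KozmaNitzan2024, §4 Lemma 11 (p. 22)] -/
theorem hclrHi_YFt (κ : Consts) {V : Type} [DecidableEq V] [Countable V] {G : SimpleGraph V} [G.LocallyFinite] (Φ : PlanarSkeletonFrmFrom G) (t : V) (p : unitInterval) (D : Skelφ.StepI.DataNS V) (c : ℕ) (mk : ℕ) (g : ℕ) (f : ℕ) (hN : EqNumL κ Φ t p D g f) (du : MDir) {σh : ℤ} (hhop : sgOf du * σh = -1 → vL κ Φ t p D g f ≤ 0) {Nr : ℕ} (hc : Nr + 1 ≤ c)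
    (htop : 2 * (hBF κ Φ t p D c mk).natAbs ≤ ℓBF κ Φ t p D c mk) (hℓb : 2 * bF κ Φ t p D c mk + 27 ≤ ℓBF κ Φ t p D c mk) :
    sgOf du * σh = -1 → ∀ k ≤ Nr, yBoxHiT (nL κ Φ t p D g f) (vL κ Φ t p D g f) (KS0.R'0 κ Φ t p D mk) k +
      sgOf du * (yLFt κ Φ t p D c mk g f (sgOf du) σh) 0 < -((Mu D : ℕ) : ℤ) := by
  intro h
  have ha := yLFt_zero κ Φ t p D c mk g f (sgOf_sign du) σh
  rw [h] at ha
  exact Skelφ.hclrM_of_clearF hN.v_le (hhop h) (KS0.R'0 κ Φ t p D mk) Nr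
    (clo := (nL κ Φ t p D g f : ℤ) - KS0.R'0 κ Φ t p D mk + ((ℓBF κ Φ t p D c mk : ℤ) - |hBF κ Φ t p D c mk| - 11))
    (by linarith [ha]) (clearF_t κ Φ t p D c mk (nL κ Φ t p D g f) hc le_rfl htop hℓb)

end ClrYF

end KS

end NegB

end PlanarSkeletonFrmFrom

end Summit.CriticalPhenomena.PercolationContinuityZ3.Theorems.Transplant

end
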